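import Summits.AtomisticToContinuum.HydrodynamicLimit.Theorems.CollisionIsometryCLTCollisionalTransferLocalityDefs
import HarnessLib

/-!
# Vocabulary of the line `hemisphere-affine-slaving`, part B: the reshape of the thermodynamic virial
(crux `CollisionalTransferLocality`, stmt-AtomisticToContinuum-9518; rank 3 of route
`StiffCollisionalRelaxation`, rank 4 of `CollisionIsometryCLT` — the two route decls are `rfl`-equal)

Definitions-only support file (`--supports stmt-AtomisticToContinuum-9518`) of the line lead (gen 1),
continuing `CollisionIsometryCLTCollisionalTransferLocalityDefs` (p77328). It makes importable the vocabulary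
in which the registered stub [B] `stub_thermodynamicVirial` is RESHAPED after the restatement of the a-priori
crux (stmt-14827: pre-shock, dilute chamber): [B] as registered quantifies over the density window
`WindowAt` (ceiling `ρ̄σ³ ≤ 1`) and therefore contains the static pressure equation
"thin-shell contact intensity `= 6(Z(η) − 1)`" for ALL reduced densities `η ≤ 1` — beyond hard-sphere
freezing `η ≈ 0.943`, where it is neither in the tree nor in print — whereas on the dilute chamber only
`η < η₀` small is consumed, where the tree PROVES it
(`Literature.MathematicalPhysics.StatisticalMechanics.HardSphereContactTheorem_holds`). The reshape:
[B] ⟸ [B-stat] (`StaticShell (6(Z−1)) η₀`: the STATIC pressure equation at low density) ∧ [B-dyn]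
(`ContactVirial … (pOf Y σ)` for every static value function `Y`: the NON-EQUILIBRIUM mesoscopic virial
theorem proper, EOS-free) on the event `DiluteAt … η₁` (dilute block ceiling, `η₁ < η₀`).

* `StaticShell Y η₀` — static thin-shell ordered-pair count per particle and unit shell thickness under the
  homogeneous canonical law at reduced density `σ³ < η₀` tends to `Y(σ³)` (`h → 0` after `N → ∞`);
* `ZPi η = 6 (Z(η) − 1)` — the tree's value function; `pOf Y σ r th = r th Y(rσ³)/6` — the collisional
  pressure built from a value function (`pOf ZPi σ = pcoll σ`, `pOf_ZPi`);
* `DiluteAt σ a₀ θ₀ u₀ Φ t φ η₁` — w.h.p. no block is denser than `η₁/σ³` on `[0, t]`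
  (`diluteAt_one_of_windowAt`: with `η₁ := 1` it is inside `WindowAt`);
* `RhsG`, `KfunG`, `ContactVirial` — `Rhs`, `Kfun`, `ThermoVirial` with a general pressure function
  (`= Rhs / Kfun / ThermoVirial` at `pcoll σ` by `rfl`);
* `CollisionalTransferLocalityPreShock` — the PRE-SHOCK / DILUTE form of the crux (prefix verbatim the
  restated a-priori crux 14827, tail verbatim the crux, `t < T` and the dilute proviso inserted after
  `∀ t, 0 < t →`): the horizon on which both routes consume the crux and on which its a-priori inputs are
  supplied; the skeleton (`Cruxes/CollisionalTransferLocality/Lines/hemisphere-affine-slaving.lean`) concludes it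
  from the Stiff route's items 9522 / 14827 / 9526 by name modulo the registered stubs, and
  `preShock_of_allTimes` (skeleton) shows the filed `∀ t > 0` form implies it. DEFINED here, never assumed.
Nothing in this file is asserted: every `def … : Prop` is a predicate the stubs prove or consume.
The lemma `diluteAt_one_of_windowAt` is a registered helper of the item (stub-add by the lead).
-/

namespace Summit.AtomisticToContinuum.HydrodynamicLimit.Theorems.HemisphereAffineSlaving

open scoped BigOperators Topology Classical ENNReal
open Filter Set Function MeasureTheory

noncomputable section

open Literature.MathematicalPhysics.KineticTheory (T3 V3)

/-! ## Static contact statistics -/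

/-- STATIC THIN-SHELL CONTACT INTENSITY with value function `Y` on reduced densities `(0, η₀)`: under
the flow-invariant homogeneous local Gibbs law (`a₀ ≡ 1`, `u₀ ≡ 0`, `θ₀ ≡ θ`; the canonical law of
`N + 1` spheres of diameter `σ(N+1)^{-1/3}` on `𝕋³`, reduced density `σ³`) the expected number of
ORDERED pairs at blown-up distance in `(σ, σ(1+h)]` per particle, divided by `h`, is within `e` of
`Y(σ³)` for `h < h₀(e)` and `N ≥ N₀(e, h)`. With `Y := ZPi` and `∃ η₀ > 0` in front this is VERBATIM
the sibling line's `stub_pressureEquation` (`Lines/conditional-covariance-liouville-rigidity.lean`). -/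
def StaticShell (Y : ℝ → ℝ) (η₀ : ℝ) : Prop :=
  ∀ σ : ℝ, 0 < σ → σ ^ 3 < η₀ → ∀ θ : ℝ, 0 < θ → ∀ e : ℝ, 0 < e → ∃ h₀ : ℝ, 0 < h₀ ∧ ∀ h : ℝ,
    0 < h → h < h₀ → ∃ N₀ : ℕ, ∀ N : ℕ, N₀ ≤ N →
    ∀ Φ : Literature.Analysis.FluidPDE.HardSphereFlow (Literature.Analysis.FluidPDE.Torus.geometry (Fin 3))
      (Literature.MathematicalPhysics.KineticTheory.hsDiameter σ N) (N + 1),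
    |h⁻¹ * (∫ z, ((N : ℝ) + 1)⁻¹ * ∑ i : Fin (N + 1), ∑ j : Fin (N + 1), (if j ≠ i ∧ σ < (((N : ℝ) + 1) ^
      ((1 : ℝ) / 3)) * Literature.Analysis.FluidPDE.Torus.euclidDist (z i).1 (z j).1 ∧ (((N : ℝ) + 1) ^ ((1 : ℝ) /
      3)) * Literature.Analysis.FluidPDE.Torus.euclidDist (z i).1 (z j).1 ≤ σ * (1 + h) then (1 : ℝ) else 0)
      ∂(Literature.MathematicalPhysics.KineticTheory.localGibbsLaw σ (fun _ => 1) (fun _ => 0) (fun _ => θ) N Φ)) -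
      Y (σ ^ 3)| ≤ e

/-- The tree's contact-intensity value function `6(Z(η) − 1) = 6 η f_ex′(η)` (`= 4π η Y(η)` with
`Y = contactValue`). -/
def ZPi (η : ℝ) : ℝ :=
  6 * (Literature.MathematicalPhysics.KineticTheory.hsCompressibility η - 1)

/-- The collisional pressure built from a contact-intensity value function:
`p_Y(r, th) = r · th · Y(rσ³)/6` (so that `p_{ZPi} = p_c`, `pOf_ZPi`). -/
def pOf (Y : ℝ → ℝ) (σ : ℝ) (r th : ℝ) : ℝ :=
  r * th * Y (r * σ ^ 3) / 6

/-! ## The dilute block ceiling -/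

/-- DILUTE BLOCK CEILING `η₁` at `(σ, profiles, Φ, t, kernel)`: w.h.p. under the local Gibbs laws no
block is denser than `η₁/σ³` at any time `s ≤ t` (the ceiling half of the a-priori window with the
ceiling matched to the dilute chamber; with `η₁ := 1` it is implied by `WindowAt`). -/
def DiluteAt (σ : ℝ) (a₀ θ₀ : T3 → ℝ) (u₀ : T3 → V3) (Φ : Flows σ) (t : ℝ) (φ : ℕ → T3 → ℝ)
    (η₁ : ℝ) : Prop :=
  Tendsto (fun N : ℕ => Literature.MathematicalPhysics.KineticTheory.localGibbsLaw σ a₀ u₀ θ₀ N (Φ N)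
    {z | ∃ s ∈ Icc 0 t, ∃ x : T3, η₁ < rhoB φ N ((Φ N).flow s z) x * σ ^ 3}) atTop (𝓝 0)

/-! ## The thermodynamic virial with a general pressure function -/

/-- `Rhs` with a general pressure function `p(ρ̄, θ̄)` in place of `p_c`. -/
def RhsG (σ : ℝ) (Φ : Flows σ) (φ : ℕ → T3 → ℝ) (ψ : ℝ → T3 → V3) (χ : ℝ → T3 → ℝ) (p : ℝ → ℝ → ℝ)
    (N : ℕ) (z : Cfg N) (τ : ℝ) : ℝ :=
  ∫ s in Icc 0 τ, ∫ x, eulerW ψ χ φ N s ((Φ N).flow s z) x *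
    p (rhoB φ N ((Φ N).flow s z) x) (thetaB φ N ((Φ N).flow s z) x)

/-- `Kfun` with a general pressure function `p(ρ̄, θ̄)` in place of `p_c`. -/
def KfunG (σ : ℝ) (Φ : Flows σ) (φ : ℕ → T3 → ℝ) (ψ : ℝ → T3 → V3) (χ : ℝ → T3 → ℝ) (p : ℝ → ℝ → ℝ)
    (N : ℕ) (z : Cfg N) (τ : ℝ) : ℝ :=
  ∫ s in Icc 0 τ, ∫ x, kinW ψ χ φ N s ((Φ N).flow s z) x *
    p (rhoB φ N ((Φ N).flow s z) x) (thetaB φ N ((Φ N).flow s z) x)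

/-- CONTACT VIRIAL LOCALITY with pressure function `p` at `(σ, profiles, Φ, kernel, t, ψ, χ)`:
uniformly in `τ ≤ t`, the slaved collision sum `S_N` equals `∫∫ eulerW·p(ρ̄,θ̄) + ∫∫ kinW·p(ρ̄,θ̄)` in
local-Gibbs probability (`p := pcoll σ` gives `ThermoVirial`, `contactVirial_pcoll_iff`). -/
def ContactVirial (σ : ℝ) (a₀ θ₀ : T3 → ℝ) (u₀ : T3 → V3) (Φ : Flows σ) (φ : ℕ → T3 → ℝ) (t : ℝ)
    (ψ : ℝ → T3 → V3) (χ : ℝ → T3 → ℝ) (p : ℝ → ℝ → ℝ) : Prop :=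
  ∀ δ : ℝ, 0 < δ → Tendsto (fun N : ℕ =>
    Literature.MathematicalPhysics.KineticTheory.localGibbsLaw σ a₀ u₀ θ₀ N (Φ N)
      {z | ∃ τ ∈ Icc 0 t, δ < |Sfun σ Φ φ ψ χ N z τ -
        (RhsG σ Φ φ ψ χ p N z τ + KfunG σ Φ φ ψ χ p N z τ)|}) atTop (𝓝 0)

/-! ## The pre-shock form of the crux (restatement target; defined, never assumed) -/

/-- **`CollisionalTransferLocality`, PRE-SHOCK / DILUTE form.** Verbatim the prefix of the restated a-priori
crux `StiffCollisionalRelaxation.AprioriBounds` (stmt-14827: `∃ σ₀ ∃ η₁ ∀ σ < σ₀`, every classical hs-Euler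
solution `(ρ, u, θ)` on `[0, T)`, every flow family whose local Gibbs laws have those fields as LLN data at
time `0`) followed by verbatim the tail of the crux, with `t < T` and the dilute proviso
`∀ s ≤ t, ∀ x, 2ρσ³ < η₁` inserted after `∀ t, 0 < t →`. -/
def CollisionalTransferLocalityPreShock : Prop :=
  ∀ (a₀ θ₀ : (UnitAddTorus (Fin 3)) → ℝ) (u₀ : (UnitAddTorus (Fin 3)) → (EuclideanSpace ℝ (Fin 3))), Continuous a₀ → Continuous θ₀ → Continuous u₀ → (∀ x, 0 < a₀ x) → (∀ x, 0 < θ₀ x) → ∃ σ₀ : ℝ, 0 < σ₀ ∧ ∃ η₁ : ℝ, 0 < η₁ ∧ ∀ σ : ℝ, 0 < σ → σ < σ₀ → ∀ (T : ℝ) (ρ θ : ℝ → (UnitAddTorus (Fin 3)) → ℝ) (u : ℝ → (UnitAddTorus (Fin 3)) → (EuclideanSpace ℝ (Fin 3))), Literature.MathematicalPhysics.KineticTheory.IsHardSphereEulerSolution σ T ρ u θ → ∀ Φ : (N : ℕ) → Literature.Analysis.FluidPDE.HardSphereFlow (Literature.Analysis.FluidPDE.Torus.geometry (Fin 3)) (Literature.MathematicalPhysics.KineticTheory.hsDiameter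 σ N) (N + 1), Literature.MathematicalPhysics.KineticTheory.TendstoHydroFieldsAt (fun N => Literature.MathematicalPhysics.KineticTheory.localGibbsLaw σ a₀ u₀ θ₀ N (Φ N)) Φ ρ u θ 0 → ∀ (γ C : ℝ) (φ : ℕ → (UnitAddTorus (Fin 3)) → ℝ), 0 < γ → γ ≤ 1 / 15 → ((∀ N, Literature.Analysis.FunctionSpaces.Torus.IsSmooth (φ N)) ∧ (∀ N y, 0 ≤ φ N y) ∧ (∀ N, ∫ y, φ N y = 1) ∧ (∀ (N : ℕ) y, ((N : ℝ) + 1) ^ (-γ) ≤ Literature.Analysis.FluidPDE.Torus.euclidDist y 0 → φ N y = 0) ∧ (∀ (N : ℕ) y, φ N y ≤ C * ((N : ℝ) + 1) ^ (3 * γ)) ∧ (∀ (N : ℕ) y, ‖Literature.Analysis.FunctionSpaces.Torus.gradient (φ N) y‖ ≤ C * ((N : ℝ) + 1) ^ (4 * γ))) → let ρb := fun (N : ℕ) (z : Literature.Analysis.FluidPDE.Config (N + 1) (Fin 3) (UnitAddTorus (Fin 3))) (x : (UnitAddTorus (Fin 3))) => Literature.MathematicalPhysics.KineticTheory.empiricalDensityField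 z (fun y => φ N (y - x)); let mb := fun (N : ℕ) (z : Literature.Analysis.FluidPDE.Config (N + 1) (Fin 3) (UnitAddTorus (Fin 3))) (x : (UnitAddTorus (Fin 3))) => Literature.MathematicalPhysics.KineticTheory.empiricalMomentumField z (fun y => φ N (y - x)); let Eb := fun (N : ℕ) (z : Literature.Analysis.FluidPDE.Config (N + 1) (Fin 3) (UnitAddTorus (Fin 3))) (x : (UnitAddTorus (Fin 3))) => Literature.MathematicalPhysics.KineticTheory.empiricalEnergyField z (fun y => φ N (y - x)); let ub := fun (N : ℕ) (z : Literature.Analysis.FluidPDE.Config (N + 1) (Fin 3) (UnitAddTorus (Fin 3))) (x : (UnitAddTorus (Fin 3))) => (ρb N z x)⁻¹ • mb N z x; let θb := fun (N : ℕ) (z : Literature.Analysis.FluidPDE.Config (N + 1) (Fin 3) (UnitAddTorus (Fin 3))) (x : (UnitAddTorus (Fin 3))) => 2 / 3 * (Eb N z x / ρb N z x - ‖mb N z x‖ ^ 2 / (2 * ρb N z x ^ 2)); let pc := fun (r th : ℝ) => Literature.MathematicalPhysics.KineticTheory.hsPressure σ r th - r * th; ∀ t : ℝ, 0 < t → t <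 T → (∀ s ∈ Icc 0 t, ∀ x, 2 * ρ s x * σ ^ 3 < η₁) → ∀ (ψ : ℝ → (UnitAddTorus (Fin 3)) → (EuclideanSpace ℝ (Fin 3))) (χ : ℝ → (UnitAddTorus (Fin 3)) → ℝ), Literature.Analysis.FunctionSpaces.Torus.IsSmoothSpaceTimeOn (Icc 0 t) ψ → Literature.Analysis.FunctionSpaces.Torus.IsSmoothSpaceTimeOn (Icc 0 t) χ → let O := fun (N : ℕ) (s : ℝ) (z : Literature.Analysis.FluidPDE.Config (N + 1) (Fin 3) (UnitAddTorus (Fin 3))) => ∫ y, ((∑ j, ψ s y.1 j * y.2 j) + χ s y.1 * (‖y.2‖ ^ 2 / 2)) ∂(Literature.Analysis.FluidPDE.empiricalMeasure z); let Cc := fun (N : ℕ) (z : Literature.Analysis.FluidPDE.Config (N + 1) (Fin 3) (UnitAddTorus (Fin 3))) (τ : ℝ) => O N τ ((Φ N).flow τ z) - O N 0 ((Φ N).flow 0 z) - ∫ s in Icc 0 τ, ((∫ y, ((∑ j, Literature.Analysis.FunctionSpaces.Torus.timeDeriv ψ s y.1 j * y.2 j) + Literature.Analysis.FunctionSpaces.Torus.timeDeriv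 χ s y.1 * (‖y.2‖ ^ 2 / 2)) ∂(Literature.Analysis.FluidPDE.empiricalMeasure ((Φ N).flow s z))) + deriv (fun r : ℝ => O N s (Literature.Analysis.FluidPDE.freeFlight (Literature.Analysis.FluidPDE.Torus.geometry (Fin 3)) r ((Φ N).flow s z))) 0); ∀ δ : ℝ, 0 < δ → Tendsto (fun N : ℕ => Literature.MathematicalPhysics.KineticTheory.localGibbsLaw σ a₀ u₀ θ₀ N (Φ N) {z | ∃ τ ∈ Icc 0 t, δ < |Cc N z τ - ∫ s in Icc 0 τ, ∫ x, (Literature.Analysis.FunctionSpaces.Torus.divergence (ψ s) x + ∑ j, Literature.Analysis.FunctionSpaces.Torus.gradient (χ s) x j * ub N ((Φ N).flow s z) x j) * pc (ρb N ((Φ N).flow s z) x) (θb N ((Φ N).flow s z) x)|}) atTop (𝓝 0)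

/-! ## Bookkeeping lemmas (sorry-free) -/

/-- `RhsG` at the collisional pressure is `Rhs`. -/
theorem RhsG_pcoll (σ : ℝ) (Φ : Flows σ) (φ : ℕ → T3 → ℝ) (ψ : ℝ → T3 → V3) (χ : ℝ → T3 → ℝ) :
    RhsG σ Φ φ ψ χ (pcoll σ) = Rhs σ Φ φ ψ χ := rfl

/-- `KfunG` at the collisional pressure is `Kfun`. -/
theorem KfunG_pcoll (σ : ℝ) (Φ : Flows σ) (φ : ℕ → T3 → ℝ) (ψ : ℝ → T3 → V3) (χ : ℝ → T3 → ℝ) :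
    KfunG σ Φ φ ψ χ (pcoll σ) = Kfun σ Φ φ ψ χ := rfl

/-- `ContactVirial` at the collisional pressure is `ThermoVirial` (definitionally). -/
theorem contactVirial_pcoll_iff (σ : ℝ) (a₀ θ₀ : T3 → ℝ) (u₀ : T3 → V3) (Φ : Flows σ) (φ : ℕ → T3 → ℝ)
    (t : ℝ) (ψ : ℝ → T3 → V3) (χ : ℝ → T3 → ℝ) :
    ContactVirial σ a₀ θ₀ u₀ Φ φ t ψ χ (pcoll σ) ↔ ThermoVirial σ a₀ θ₀ u₀ Φ φ t ψ χ := Iff.rfl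

/-- `p_{6(Z−1)} = p_c`: `r th · 6(Z(rσ³) − 1)/6 = r th Z(rσ³) − r th`. -/
theorem pOf_ZPi (σ : ℝ) : pOf ZPi σ = pcoll σ := by
  funext r th
  simp only [pOf, ZPi, pcoll, Literature.MathematicalPhysics.KineticTheory.hsPressure]
  ring

/-- **Registered helper `diluteAt_one_of_windowAt`.** The ceiling-`1` dilute event is inside the
`WindowAt` event: `WindowAt σ a₀ θ₀ u₀ Φ t φ → DiluteAt σ a₀ θ₀ u₀ Φ t φ 1`. [folklore] -/
theorem diluteAt_one_of_windowAt : ∀ {σ : ℝ} {a₀ θ₀ : T3 → ℝ} {u₀ : T3 → V3} {Φ : Flows σ} {t : ℝ} {φ : ℕ → T3 → ℝ}, WindowAt σ a₀ θ₀ u₀ Φ t φ → DiluteAt σ a₀ θ₀ u₀ Φ t φ 1 := by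
  intro σ a₀ θ₀ u₀ Φ t φ hW
  obtain ⟨c₁, -, hc⟩ := hW
  refine tendsto_of_tendsto_of_tendsto_of_le_of_le tendsto_const_nhds hc (fun N => bot_le)
    (fun N => measure_mono ?_)
  rintro z ⟨s, hs, x, hx⟩
  exact ⟨s, hs, x, Or.inr (by simpa [rhoB] using hx)⟩

end

end Summit.AtomisticToContinuum.HydrodynamicLimit.Theorems.HemisphereAffineSlaving
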